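import Mathlib
import HarnessLib
import Summits.ResolutionOfSingularities.ResolutionOfSingularities.Theorems.WildQuotientsWildQuotientResolutionS1aReachAux
import Summits.ResolutionOfSingularities.ResolutionOfSingularities.Theorems.WildQuotientsWildQuotientResolutionS1aWinsOfOrbitRule

/-!
# S1a — `WinsOfAuxReachRule p` PROVED: the registered stub ⇐ `KillTouchReachAux p ∧ AuxWithinReachAux p` (research stubs on aux-reachable models only)

[OURS · L1 W4.5c · lead-1 g9; the `Theses`-cone wrapper of `…S1aReachAux`] — NOT statements of the manuscript; counted 0; AI-level work, weaker than
expert review. Crux stmt-ResolutionOfSingularities-17941, line `s1a-logminvertex` v10, registered stub `stub_winningStrategy`.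

* ★★ `winningStrategy_of_killTouchReachAux_of_auxWithinReachAux : p.Prime → KillTouchReachAux p → AuxWithinReachAux p → FrameWins.WinningStrategy p` —
  `wins_of_touchOrTopOrOrbitSeq_aux` with `P := ReachableAux (initial)`;
* `WinsOfAuxReachRule p`, `winsOfAuxReachRule`; `winsOfOrbitRule_of_winsOfAuxReachRule` (the v9 residual follows);
* `cyclicQuotientFourfolds_of_door_of_killTouchReachAux_of_auxWithinReachAux`.
-/

set_option linter.dupNamespace false

noncomputable section

open CategoryTheory Limits AlgebraicGeometry TopologicalSpace
open Literature.AlgebraicGeometry.Resolution Literature.AlgebraicGeometry.RelativeSpec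
open Summit.ResolutionOfSingularities.ResolutionOfSingularities.Theorems.WildQuotientResolution.S1
open Summit.ResolutionOfSingularities.ResolutionOfSingularities.Theorems.WildQuotientResolution.S1.NodeAtlas
open Summit.ResolutionOfSingularities.ResolutionOfSingularities.Theorems.WildQuotientResolution.S1.GameFrame

namespace Summit.ResolutionOfSingularities.ResolutionOfSingularities.Theorems.WildQuotientResolution.S1

/-- ★★ **THE TERMINATION CRUX FROM THE AUX-REACHABLE FORMS**: `KillTouchReachAux p ∧ AuxWithinReachAux p ⇒ WinningStrategy p` (`p` prime), by
`wins_of_touchOrTopOrOrbitSeq_aux` with the invariant class `P := ReachableAux (initial)`. [OURS · L1 W4.5c] -/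
theorem winningStrategy_of_killTouchReachAux_of_auxWithinReachAux {p : ℕ} (hp : p.Prime) (hK : KillTouchReachAux p) (hA : AuxWithinReachAux p) :
    FrameWins.WinningStrategy p := by
  intro k _ _ _ X' X₁ f q G _ _ ρ hG hfs hfft hfqc hX₁ _ hreg hqfin hqs hqet hq horb hdim hinj g₀ hg₀ _ h₀
  haveI := hfft
  haveI := hfqc
  haveI := hqfin
  have HK := hK k X' X₁ f q G ρ hG hfs hfft hfqc hX₁ hreg hqfin hqs hqet hq horb hdim hinj g₀ hg₀ h₀
  have HA := hA k X' X₁ f q G ρ hG hfs hfft hfqc hX₁ hreg hqfin hqs hqet hq horb hdim hinj g₀ hg₀ h₀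
  refine GameFrame.GModel.wins_of_touchOrTopOrOrbitSeq_aux hp hg₀ ((GameFrame.GModel.initial hq h₀).ReachableAux)
    (fun M M' 𝒦 d hR haux hmv => GameFrame.GModel.ReachableAux.move 𝒦 d hR haux hmv)
    (fun M _ => GameFrame.GModel.hasNoetherianBase_of_datum f M) (fun M _ => GameFrame.GModel.exists_nat_nu1_lt_of_datum f M)
    (fun M _ => GameFrame.GModel.compactSpace_of_datum f M)
    (fun M hR hT => ?_) (GameFrame.GModel.initial hq h₀) GameFrame.GModel.ReachableAux.refl
  by_cases hj : M.jInf = ⊥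
  · exact Or.inl ⟨hj, HK M hR hT hj⟩
  · rcases HA M hR hT hj with ⟨n, hn⟩ | ⟨n, hn⟩
    · exact Or.inr (Or.inl ⟨n, GameFrame.GModel.auxAltWithin_of_auxTopWithin hp hg₀
        (fun M => GameFrame.GModel.hasNoetherianBase_of_datum f M) n M hn⟩)
    · exact Or.inr (Or.inr ⟨n, hn⟩)

/-- **`WinsOfAuxReachRule p`**: the game side of the residual after the third lead-1 g9 reshape. [OURS · L1 W4.5c] -/
def WinsOfAuxReachRule (p : ℕ) : Prop :=
  p.Prime → KillTouchReachAux p → AuxWithinReachAux p → FrameWins.WinningStrategy p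

/-- ★★ **`WinsOfAuxReachRule p` HOLDS** for every `p`. [OURS · L1 W4.5c] -/
theorem winsOfAuxReachRule (p : ℕ) : WinsOfAuxReachRule p :=
  fun hp hK hA => winningStrategy_of_killTouchReachAux_of_auxWithinReachAux hp hK hA

/-- Nothing is lost: the v9 residual `WinsOfOrbitRule p` follows. [OURS · L1 W4.5c] -/
theorem winsOfOrbitRule_of_winsOfAuxReachRule {p : ℕ} (h : WinsOfAuxReachRule p) : WinsOfOrbitRule p :=
  fun hp hK hA => h hp (killTouchReachAux_of_killTouchReach hK) (auxWithinReachAux_of_auxWithinReach hA)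

/-- **Door + the two research statements (aux-reachable forms) ⇒ the sub-crux `CyclicQuotientFourfolds`.** [OURS · L1 W4.5c] -/
theorem cyclicQuotientFourfolds_of_door_of_killTouchReachAux_of_auxWithinReachAux (hD : FrameWins.DoorStatement)
    (hK : ∀ p : ℕ, p.Prime → KillTouchReachAux p) (hA : ∀ p : ℕ, p.Prime → AuxWithinReachAux p) :
    Summit.ResolutionOfSingularities.ResolutionOfSingularities.Theses.WildQuotients.CyclicQuotientFourfolds :=
  FrameWins.cyclicQuotientFourfolds_of_door_of_wins hD fun p hp _ =>
    winningStrategy_of_killTouchReachAux_of_auxWithinReachAux hp (hK p hp) (hA p hp)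

end Summit.ResolutionOfSingularities.ResolutionOfSingularities.Theorems.WildQuotientResolution.S1

end
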